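import Summits.Ventures.DiscreteObjects.PP12.FlagSevenIndexSets
import Summits.Ventures.DiscreteObjects.PP12.FlagSevenOrbitMatrix
import Summits.Ventures.DiscreteObjects.PP12.FlagTenDataFin

/-!
# The `f = 7` flag-cell orbit data READ OFF a plane: the `FlagSevenOrbitData` of a plane (kernel; Step B of the FlagSevenOrbitReduction roadmap)
Framing: lottery ticket; floor = certified bounds/negative ranges.

Cell pub-namedobj (venture DiscreteObjects), target (M), designs gen 14; sibling of `FlagTenOrbitDataOfPlane` / `FlagTenDataFin` (`f = 10`).
Setting: projective plane of order 12, flag-type collineation `σ` (`σ³ = 1`) with exactly 7 fixed points, and two non-fixed lines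
`u₀, u₁ ∋ c` in different orbits (`FlagSevenIndexSets.exists_second_cline`; the two c-line orbits `Γ₀ = orb3 u₀`, `Γ₁ = orb3 u₁`).
This file DEFINES `flagSevenDataOfPlane : FlagSevenOrbitData` (designs g13's structure, p327216) from the plane:
* index types: triangles of class `s` = points `≠ c` of `cl s` (`cl 0 = u₀`, `cl 1 = u₁`; `Fin 12` each, `eTri7`), fixed lines `≠ l` and fixed
  points `≠ c` (`Fin 6`, `eFixL6` / `eFixP6`), orbits of non-fixed points of `l` (`Fin 2`, `eZ`), orbits on a fixed line / line orbits through
  a fixed point (`Fin 4`, `FlagTenDataFin.eOrbOn` / `eLOrb`, valid for every `f`);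
* `κ s i` = the `l`-orbit of the point `sideOf x ∩ l`; `ψ s i` = the vertex on `cl s` of the triangle of the ODD POINT `sideOf x ∩ σ²(cl s)`
  (`oddVertex`); `R s i` = the triangles of the other class meeting the side `sideOf x`; `γ s i j` = `gammaOrb`; `C k t s` = the triangles of
  class `s` whose line to `y_k` lies in the line orbit `t`; `β k t j` = `betaOrb` — read off with the plane-level functions of
  `FlagTenOrbitDataOfPlane` (which do not depend on `f`);
* `flagSevenDataOfPlane_psi_ne` — conjunct 1 of `IsFlagSevenOrbitMatrix` (`ψ s i ≠ i`: the odd point is not an own vertex).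
What remains for `FlagSevenOrbitReduction` (Steps C–D): the entries of the orbit matrix as incidence counts (`entry r c = |S_c ∩ a_r|`), the
other shape conjuncts, and the transport of `OrbitSideIdentities.orbit_row_identity_orbits` / `orbit_column_identity_orbits` along the
bijections `F7Row ≃` non-trivial line orbits, `F7Col ≃` non-trivial point orbits. No `sorry`, no new axioms.
-/

namespace Summit.Ventures.DiscreteObjects.PP12

open Configuration Finset
open scoped Classical

namespace Collineation

variable {P L : Type*} [Membership P L] [ProjectivePlane P L] [Fintype P] [Fintype L] (σ : Collineation P L)

/-- The two chosen c-lines, indexed by `Fin 2`. -/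
def cl (u₀ u₁ : L) (s : Fin 2) : L := if s = 0 then u₀ else u₁

omit [ProjectivePlane P L] [Fintype P] [Fintype L] in
/-- `cl s` passes through `c` and is not fixed. -/
theorem cl_spec {c : P} {u₀ u₁ : L} (hcu₀ : c ∈ u₀) (hu₀ : σ.onLines u₀ ≠ u₀) (hcu₁ : c ∈ u₁) (hu₁ : σ.onLines u₁ ≠ u₁) (s : Fin 2) :
    c ∈ cl u₀ u₁ s ∧ σ.onLines (cl u₀ u₁ s) ≠ cl u₀ u₁ s := by
  unfold cl; split_ifs
  · exact ⟨hcu₀, hu₀⟩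
  · exact ⟨hcu₁, hu₁⟩

/-- orbits of the non-fixed points of `l` (the index set of `Z_t`) -/
abbrev ZIdx (l : L) : Type _ := ((univ.filter fun p : P => p ∈ l ∧ σ.onPoints p ≠ p).image (orb3 σ.onPoints) : Finset (Finset P))

/-- The vertex on `u` of the triangle of the odd point of the side of `x` (`x ∈ u`, `u` a non-fixed c-line): `σ (sideOf x ∩ σ²u)`. -/
noncomputable def oddVertex (l : L) (c : P) (u : L) (x : P) : P := σ.onPoints (meetPt c (σ.sideOf l x) (σ.onLines (σ.onLines u)))

section Flag

variable {l : L} {c : P} (hl : σ.onLines l = l) (hc : σ.onPoints c = c) (hcl : c ∈ l)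
  (hP : ∀ p : P, σ.onPoints p = p → p ∈ l) (hL : ∀ m : L, σ.onLines m = m → c ∈ m)
  (h12 : ProjectivePlane.order P L = 12)

include hl hP h12 in
/-- `Fin 2 ≃` orbits of non-fixed points of `l` (`f = 7`). -/
theorem card_zIdx (hq : σ.onPoints ^ 3 = 1) (hf : fixedCard σ.onPoints = 7) : Fintype.card (σ.ZIdx l) = 2 := by
  rw [Fintype.card_coe]; exact σ.card_lpointOrbits_eq_two hl hP h12 hq hf

include hl hc in
/-- `Fin 6 ≃` fixed lines `≠ l` (`f = 7`). -/
theorem card_fixLIdx_six (hf : fixedCard σ.onPoints = 7) : Fintype.card (σ.FixLIdx l) = 6 := by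
  rw [Fintype.card_subtype]; exact (σ.card_fixed_ne_eq_six hf hl hc).1

include hl hc in
/-- `Fin 6 ≃` fixed points `≠ c` (`f = 7`). -/
theorem card_fixPIdx_six (hf : fixedCard σ.onPoints = 7) : Fintype.card (σ.FixPIdx c) = 6 := by
  rw [Fintype.card_subtype]; exact (σ.card_fixed_ne_eq_six hf hl hc).2

omit [Fintype L] in
include hl hc hcl hP in
/-- The `l`-point of the side of an exterior `x`: the orbit of `sideOf x ∩ l` is one of the orbits of non-fixed points of `l`. -/
theorem sideZ_mem {x : P} (hxX : ∀ m : L, σ.onLines m = m → x ∉ m) :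
    orb3 σ.onPoints (meetPt c (σ.sideOf l x) l) ∈ (univ.filter fun p : P => p ∈ l ∧ σ.onPoints p ≠ p).image (orb3 σ.onPoints) := by
  have hxf : σ.onPoints x ≠ x := σ.not_fixed_of_exterior_flag hl hP hxX
  obtain ⟨hxa, hσxa⟩ := σ.sideOf_spec l hxf
  obtain ⟨-, ha0⟩ := σ.side_no_fixed_point hxf hxX hxa hσxa
  have hal : σ.sideOf l x ≠ l := fun e => ha0 c hc (by rw [e]; exact hcl)
  obtain ⟨hza, hzl⟩ := meetPt_spec c hal
  exact σ.lpointOrbit_mem hzl (fun e => ha0 _ e hza)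

include hl hc hP hL in
/-- `oddVertex` is a point `≠ c` of `u`, and it is not the vertex `x` itself (the odd point is not an own vertex: `σ²x ∉ x·σx`). -/
theorem oddVertex_spec (hq : σ.onPoints ^ 3 = 1) {u : L} (hcu : c ∈ u) (hu : σ.onLines u ≠ u) {x : P} (hxu : x ∈ u) (hxc : x ≠ c) :
    σ.oddVertex l c u x ∈ u ∧ σ.oddVertex l c u x ≠ c ∧ σ.oddVertex l c u x ≠ x := by
  have hqL : σ.onLines ^ 3 = 1 := σ.onLines_pow_eq_one hq
  have h3 := apply_three σ.onPoints hq
  have h3L := apply_three σ.onLines hqL u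
  have hxX := σ.exterior_of_mem_cline hL hcu hu hxu hxc
  have hxf : σ.onPoints x ≠ x := σ.not_fixed_of_exterior_flag hl hP hxX
  obtain ⟨hxa, hσxa⟩ := σ.sideOf_spec l hxf
  obtain ⟨-, ha0⟩ := σ.side_no_fixed_point hxf hxX hxa hσxa
  have hcσ : ∀ v : L, c ∈ v → c ∈ σ.onLines v := fun v hv => by have := σ.mem_map hv; rwa [hc] at this
  have hcu2 : c ∈ σ.onLines (σ.onLines u) := hcσ _ (hcσ _ hcu)
  have hau2 : σ.sideOf l x ≠ σ.onLines (σ.onLines u) := fun e => ha0 c hc (by rw [e]; exact hcu2)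
  obtain ⟨hoa, hou2⟩ := meetPt_spec c hau2
  unfold oddVertex
  refine ⟨?_, ?_, ?_⟩
  · have := σ.mem_map hou2; rw [h3L] at this; exact this
  · intro e
    have hoc : meetPt c (σ.sideOf l x) (σ.onLines (σ.onLines u)) = c := σ.onPoints.injective (e.trans hc.symm)
    exact ha0 c hc (hoc ▸ hoa)
  · intro e
    -- σ o = x ⇒ o = σ² x, and σ²x ∈ x·σx would make the side a fixed line
    have ho : meetPt c (σ.sideOf l x) (σ.onLines (σ.onLines u)) = σ.onPoints (σ.onPoints x) := by
      apply σ.onPoints.injective; rw [e, h3]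
    have hσ2xa : σ.onPoints (σ.onPoints x) ∈ σ.sideOf l x := ho ▸ hoa
    exact (σ.orbit_triangle hq hxf hxX).2.2.2 _ hxa hσxa hσ2xa

/-! ### The data -/

section Data

variable (hl : σ.onLines l = l) (hc : σ.onPoints c = c) (hcl : c ∈ l)
  (hP : ∀ p : P, σ.onPoints p = p → p ∈ l) (hL : ∀ m : L, σ.onLines m = m → c ∈ m) (h12 : ProjectivePlane.order P L = 12)
  (hq : σ.onPoints ^ 3 = 1) (hf : fixedCard σ.onPoints = 7) {u₀ u₁ : L} (hcu₀ : c ∈ u₀) (hu₀ : σ.onLines u₀ ≠ u₀)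
  (hcu₁ : c ∈ u₁) (hu₁ : σ.onLines u₁ ≠ u₁)

/-- `Fin 12 ≃` the triangle index of class `s`. -/
noncomputable def eTri7 (s : Fin 2) : Fin 12 ≃ TriIdx (P := P) c (cl u₀ u₁ s) :=
  (Fintype.equivFinOfCardEq (card_triIdx (P := P) h12 (σ.cl_spec hcu₀ hu₀ hcu₁ hu₁ s).1)).symm
/-- `Fin 6 ≃` fixed lines `≠ l`. -/
noncomputable def eFixL6 : Fin 6 ≃ σ.FixLIdx l := (Fintype.equivFinOfCardEq (σ.card_fixLIdx_six hl hc hf)).symm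
/-- `Fin 6 ≃` fixed points `≠ c`. -/
noncomputable def eFixP6 : Fin 6 ≃ σ.FixPIdx c := (Fintype.equivFinOfCardEq (σ.card_fixPIdx_six hl hc hf)).symm
/-- `Fin 2 ≃` orbits of non-fixed points of `l`. -/
noncomputable def eZ : Fin 2 ≃ σ.ZIdx l := (Fintype.equivFinOfCardEq (σ.card_zIdx hl hP h12 hq hf)).symm

omit [Fintype P] [Fintype L] in
/-- A vertex of class `s` (a point `≠ c` of `cl s`) is exterior. -/
theorem exterior_of_triIdx (s : Fin 2) (x : TriIdx (P := P) c (cl u₀ u₁ s))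
    (hcu₀ : c ∈ u₀) (hu₀ : σ.onLines u₀ ≠ u₀) (hcu₁ : c ∈ u₁) (hu₁ : σ.onLines u₁ ≠ u₁)
    (hL : ∀ m : L, σ.onLines m = m → c ∈ m) : ∀ m : L, σ.onLines m = m → x.1 ∉ m :=
  σ.exterior_of_mem_cline hL (σ.cl_spec hcu₀ hu₀ hcu₁ hu₁ s).1 (σ.cl_spec hcu₀ hu₀ hcu₁ hu₁ s).2 x.2.1 x.2.2

/-- **The `FlagSevenOrbitData` of a plane** (Step B): `κ, ψ, R, γ, C, β` read off the plane and transported to `Fin` types. -/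
noncomputable def flagSevenDataOfPlane : FlagSevenOrbitData :=
  { κ := fun s i => (σ.eZ hl hP h12 hq hf).symm
      ⟨orb3 σ.onPoints (meetPt c (σ.sideOf l (σ.eTri7 h12 hcu₀ hu₀ hcu₁ hu₁ s i).1) l),
        σ.sideZ_mem hl hc hcl hP (σ.exterior_of_triIdx s (σ.eTri7 h12 hcu₀ hu₀ hcu₁ hu₁ s i) hcu₀ hu₀ hcu₁ hu₁ hL)⟩
    ψ := fun s i => (σ.eTri7 h12 hcu₀ hu₀ hcu₁ hu₁ s).symm
      ⟨σ.oddVertex l c (cl u₀ u₁ s) (σ.eTri7 h12 hcu₀ hu₀ hcu₁ hu₁ s i).1,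
        (σ.oddVertex_spec hl hc hP hL hq (σ.cl_spec hcu₀ hu₀ hcu₁ hu₁ s).1 (σ.cl_spec hcu₀ hu₀ hcu₁ hu₁ s).2
          (σ.eTri7 h12 hcu₀ hu₀ hcu₁ hu₁ s i).2.1 (σ.eTri7 h12 hcu₀ hu₀ hcu₁ hu₁ s i).2.2).1,
        (σ.oddVertex_spec hl hc hP hL hq (σ.cl_spec hcu₀ hu₀ hcu₁ hu₁ s).1 (σ.cl_spec hcu₀ hu₀ hcu₁ hu₁ s).2
          (σ.eTri7 h12 hcu₀ hu₀ hcu₁ hu₁ s i).2.1 (σ.eTri7 h12 hcu₀ hu₀ hcu₁ hu₁ s i).2.2).2.1⟩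
    R := fun s i => univ.filter fun i' : Fin 12 =>
      ∃ q ∈ orb3 σ.onPoints (σ.eTri7 h12 hcu₀ hu₀ hcu₁ hu₁ (1 - s) i').1, q ∈ σ.sideOf l (σ.eTri7 h12 hcu₀ hu₀ hcu₁ hu₁ s i).1
    γ := fun s i j => (σ.eOrbOn hc hcl hP hL h12 hq (σ.eFixL6 hl hc hf j)).symm
      ⟨σ.gammaOrb l c (σ.eFixL6 hl hc hf j).1 (σ.eTri7 h12 hcu₀ hu₀ hcu₁ hu₁ s i).1,
        (σ.gammaOrb_mem hl hc hP hL (σ.exterior_of_triIdx s (σ.eTri7 h12 hcu₀ hu₀ hcu₁ hu₁ s i) hcu₀ hu₀ hcu₁ hu₁ hL)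
          (σ.eFixL6 hl hc hf j).2.1).1⟩
    C := fun k t s => univ.filter fun i : Fin 12 =>
      σ.cOrb l (σ.eFixP6 hl hc hf k).1 (σ.eTri7 h12 hcu₀ hu₀ hcu₁ hu₁ s i).1 = ((σ.eLOrb hl hcl hP hL h12 hq (σ.eFixP6 hl hc hf k)) t).1
    β := fun k t j => (σ.eOrbOn hc hcl hP hL h12 hq (σ.eFixL6 hl hc hf j)).symm
      ⟨σ.betaOrb c (σ.eFixL6 hl hc hf j).1 ((σ.eLOrb hl hcl hP hL h12 hq (σ.eFixP6 hl hc hf k)) t).1, by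
        obtain ⟨b, hb, hbeq⟩ := mem_image.1 ((σ.eLOrb hl hcl hP hL h12 hq (σ.eFixP6 hl hc hf k)) t).2
        rw [mem_filter] at hb
        rw [← hbeq]
        exact σ.betaOrb_mem hc hcl hP hL hq (σ.eFixP6 hl hc hf k).2.1 (σ.eFixP6 hl hc hf k).2.2 hb.2.1 hb.2.2
          (σ.eFixL6 hl hc hf j).2.1 (σ.eFixL6 hl hc hf j).2.2⟩ }

/-- **Conjunct 1 of `IsFlagSevenOrbitMatrix`:** `ψ s i ≠ i` (the odd point of a side is not one of its own vertices). -/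
theorem flagSevenDataOfPlane_psi_ne (s : Fin 2) (i : Fin 12) :
    (σ.flagSevenDataOfPlane hl hc hcl hP hL h12 hq hf hcu₀ hu₀ hcu₁ hu₁).ψ s i ≠ i := by
  set e := σ.eTri7 h12 hcu₀ hu₀ hcu₁ hu₁ s with he
  have hsp := σ.oddVertex_spec hl hc hP hL hq (σ.cl_spec hcu₀ hu₀ hcu₁ hu₁ s).1 (σ.cl_spec hcu₀ hu₀ hcu₁ hu₁ s).2 (e i).2.1 (e i).2.2
  intro h
  have hψ : (σ.flagSevenDataOfPlane hl hc hcl hP hL h12 hq hf hcu₀ hu₀ hcu₁ hu₁).ψ s i = e.symm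
      ⟨σ.oddVertex l c (cl u₀ u₁ s) (e i).1, hsp.1, hsp.2.1⟩ := rfl
  rw [hψ] at h
  have := congrArg (fun i₀ => (e i₀).1) h
  simp only [Equiv.apply_symm_apply] at this
  exact hsp.2.2 this

end Data

end Flag

end Collineation

end Summit.Ventures.DiscreteObjects.PP12
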